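import Summits.Ventures.HSemireg.WedgeWeilKernel

/-!
# Venture HSemireg — THEOREM R-B in the wedge model (4/9)

HONEST FRAMING. Part of the Lean index of the computation cell `pub-hsemireg` (seat p3; Sunday enclosure of the
FORMULA-N kernel assets of seats th-7 / th-6, ENCLOSURE-PLAN-p3.md).  Finite-dimensional exterior algebra over a field ONLY:
no variety, no cohomology theory, no semiregularity map is constructed here; nothing here says that HC / HC_CM / HC_AV holds;
no Literature fact is declared or used.  The geometric DICTIONARY (why these ranks are the `HT`-side box ranks of the cell's
STRUCTURE.md §1 / theory/FORMULA-N.md) lives in theory/FORMULA-N-th7.md PART B §A.3 / §N and is NOT asserted in Lean.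

THEOREM R-B (FORMULA-N PART B §L.3 / §L.8; STRUCTURE D9, (F1) Weil-frame clause, C16) in the SIGN-FREE transposed wedge model — theory/th7/WeilRank.lean v3 sha256/16 7e5d6bad1a94e25a (th-7 g4, 18:46Z; ×2 farm th-2 g20 18:48:20Z); PART R/R2/R3 = l.1506–3436 on top of HankelRank v1 (= the tree's Wedge/WedgeHankel* files), VERBATIM up
to namespaces (`HSemiregWeil` ↦ `Summit.Ventures.HSemireg.Wedge.Weil`, which sees the wedge-model infrastructure `….Wedge` and opens `….Wedge.Hankel`), file 4 of 9.
MODEL: `N` pairs of generators `x_c`, `y_c`; the h-part `f = w_N(q)` (HankelRank); the «Weil vectors» `w₊ = E_{G₋}`, `w₋ = E_{G₊}` = the full monomials on the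
generator blocks of the last `N − p` / first `p` pairs (signature `(p, N − p)`; THEOREM R is `N = 2n`, `p = n`).  HEADLINES (files 5, 8, 9): `weilRank` /
`weilRank_nn` («rank(⌟v ∣ HT²) = (4 + ρ)·n² − 2n», `v = f + a w₊ + b w₋`, `ab ≠ 0`, `n ≥ 3`, ρ = rank H₂(q)), `ker_eq` (kernel = mixed 2-forms killing `f`),
`weilRank_deg` / `weilRank_nn_deg` (every degree `m`, `m + 1 ≤ N − p`), `weilRank_one` / `weilRank_nn_one` (one-sided, ε = 1).  No permutation sign is evaluated
(the pair symmetries act through `AlternatingMap.map_perm`; `sgn κ` is a unit).  This file: the pair pieces `Pset s` of `Λ²`, their supports `Ppred` / `Qpred`, disjointness, and the permutation bookkeeping `dup_mul` / `dup_one`.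
-/

open Module Set Set.powersetCard Summit.Ventures.HSemireg.Wedge.Hankel

namespace Summit.Ventures.HSemireg.Wedge.Weil

variable (K : Type*) [Field K]

/-! ### The per-pair pieces of `Λ²N` and of the degree-2 image of `∧ f` -/

section Pieces

variable (N : ℕ)

/-- the piece of `Λ²N` on the pair set `s ⊆ Fin N` (used for `|s| = 2`): products of one generator from each pair. -/
noncomputable def Pset (s : Finset (Fin N)) : Submodule K (HT K (In N)) :=
  Submodule.span K {z | ∃ i j : In N, pr i ∈ s ∧ pr j ∈ s ∧ pr i ≠ pr j ∧ z = gx K i * gx K j}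

/-- the support family of `(∧ f)(Pset s)`: monomials whose DOUBLED pairs are exactly `s`. -/
def Qpred (s : Finset (Fin N)) (r : Finset (In N)) : Prop := ∀ i : In N, (i ∈ r ∧ pt i ∈ r) ↔ pr i ∈ s

/-- the support family of `Pset s` itself: 2-sets with pair image `s`. -/
def Ppred (s : Finset (Fin N)) (t : Finset (In N)) : Prop := t.card = 2 ∧ t.image pr = s

variable {N}

/-- `x ∧ y` over two distinct pairs of `s` lies in the pair piece `Pset s`. -/
lemma gx_mul_gx_mem_Pset {s : Finset (Fin N)} {i j : In N} (hi : pr i ∈ s) (hj : pr j ∈ s) (hij : pr i ≠ pr j) :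
    gx K i * gx K j ∈ Pset K N s :=
  Submodule.subset_span ⟨i, j, hi, hj, hij, rfl⟩

omit [Field K] in
/-- `{i} ∪ {j} = {i, j}`. -/
lemma singleton_union_singleton (i j : In N) : ({i} : Finset (In N)) ∪ {j} = {i, j} := by
  ext x; simp

/-- the product of two generators is a structure constant times the pair monomial. -/
lemma gx_mul_gx (i j : In N) : gx K i * gx K j = u K {i} {j} • B K (In N) {i, j} := by
  rw [gx, gx, B_mul_B, singleton_union_singleton]

omit [Field K] in
/-- generators in different pairs are different. -/
lemma ne_of_pr_ne {i j : In N} (h : pr i ≠ pr j) : i ≠ j := fun e => h (e ▸ rfl)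

/-- the pair monomial as a unit multiple of the product of its generators. -/
lemma B_pair_eq {i j : In N} (hij : i ≠ j) : B K (In N) {i, j} = (u K {i} {j})⁻¹ • (gx K i * gx K j) := by
  rw [gx_mul_gx, smul_smul, inv_mul_cancel₀ (u_pair_ne_zero K hij), one_smul]

/-- a product of two generators lies in `Λ²`. -/
lemma gx_mul_gx_mem_Hom (i j : In N) : gx K i * gx K j ∈ Hom K (In N) Finset.univ 2 := by
  by_cases hij : i = j
  · subst hij; rw [gx_mul_self]; exact Submodule.zero_mem _
  · rw [gx_mul_gx]
    exact Submodule.smul_mem _ _ (B_mem_Hom K (Finset.subset_univ _) (Finset.card_pair hij))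

/-- `Pset s ≤ Λ²`. -/
lemma Pset_le_Hom (s : Finset (Fin N)) : Pset K N s ≤ Hom K (In N) Finset.univ 2 := by
  apply Submodule.span_le.mpr
  rintro _ ⟨i, j, _, _, _, rfl⟩
  exact gx_mul_gx_mem_Hom K i j

/-- `Pset s ≤ Sp (Ppred s)` for `|s| = 2`. -/
lemma Pset_le_Sp {s : Finset (Fin N)} (hs : s.card = 2) : Pset K N s ≤ Sp K (Ppred (N := N) s) := by
  classical
  apply Submodule.span_le.mpr
  rintro _ ⟨i, j, hi, hj, hij, rfl⟩
  have hne : i ≠ j := ne_of_pr_ne hij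
  rw [gx_mul_gx]
  refine Submodule.smul_mem _ _ (B_mem_Sp ⟨Finset.card_pair hne, ?_⟩)
  rw [Finset.image_insert, Finset.image_singleton]
  apply Finset.eq_of_subset_of_card_le
  · intro c hc
    rcases Finset.mem_insert.mp hc with hc | hc
    · exact hc ▸ hi
    · rw [Finset.mem_singleton] at hc; exact hc ▸ hj
  · rw [hs, Finset.card_pair hij]

omit [Field K] in
/-- the supports of different pair pieces are disjoint. -/
lemma Ppred_disjoint {s s' : Finset (Fin N)} (h : s ≠ s') (t : Finset (In N)) : Ppred N s t → ¬ Ppred N s' t :=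
  fun h1 h2 => h (h1.2.symm.trans h2.2)

/-- **the image bound:** `(Pset s) ∧ f ⊆ Sp (Qpred s)` — the doubled pairs of a product `x_i x_j · (transversal)`
are exactly the pairs of `i` and `j`. -/
lemma map_f_Pset_le {s : Finset (Fin N)} (hs : s.card = 2) (p : ℕ) (q : ℕ → K) :
    (Pset K N s).map (LinearMap.mulRight K (w K N N q)) ≤ Sp K (Qpred (N := N) s) := by
  classical
  rw [Submodule.map_le_iff_le_comap]
  apply Submodule.span_le.mpr
  rintro _ ⟨i, j, hi, hj, hij, rfl⟩
  rw [SetLike.mem_coe, Submodule.mem_comap, LinearMap.mulRight_apply, gx_mul_gx, smul_mul_assoc]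
  refine Submodule.smul_mem _ _ (mul_mem_Sp (P := fun t => t = {i, j}) (Q := Fsupp (N := N) p)
    (R := Qpred (N := N) s) ?_ (B_mem_Sp rfl) (f_mem_Sp K p q))
  intro s₁ t hd hs₁ ht
  subst hs₁
  have htr := ht.1
  -- the pair image {pr i, pr j} is all of s
  have himg : ∀ c, c ∈ s ↔ c = pr i ∨ c = pr j := by
    have e : ({pr i, pr j} : Finset (Fin N)) = s := by
      apply Finset.eq_of_subset_of_card_le
      · intro c hc
        rcases Finset.mem_insert.mp hc with hc | hc
        · exact hc ▸ hi
        · rw [Finset.mem_singleton] at hc; exact hc ▸ hj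
      · rw [hs, Finset.card_pair hij]
    intro c; rw [← e]; simp
  have hi_t : i ∉ t := fun h => Finset.disjoint_left.mp hd (by simp) h
  have hj_t : j ∉ t := fun h => Finset.disjoint_left.mp hd (by simp) h
  have hpi : pt i ∈ t := by by_contra h; exact hi_t ((htr i).mpr h)
  have hpj : pt j ∈ t := by by_contra h; exact hj_t ((htr j).mpr h)
  intro i'
  simp only [Finset.mem_union, Finset.mem_insert, Finset.mem_singleton]
  constructor
  · rintro ⟨h1, h2⟩
    rw [himg]
    by_contra hc
    obtain ⟨hc1, hc2⟩ := not_or.mp hc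
    -- i' and pt i' are not among i, j, hence both lie in t: contradiction with transversality
    have a1 : i' ≠ i := fun e => hc1 (e ▸ rfl)
    have a2 : i' ≠ j := fun e => hc2 (e ▸ rfl)
    have a3 : pt i' ≠ i := fun e => hc1 (by rw [← e, pr_pt])
    have a4 : pt i' ≠ j := fun e => hc2 (by rw [← e, pr_pt])
    have b1 : i' ∈ t := by rcases h1 with (h | h) | h; exact (a1 h).elim; exact (a2 h).elim; exact h
    have b2 : pt i' ∈ t := by rcases h2 with (h | h) | h; exact (a3 h).elim; exact (a4 h).elim; exact h
    exact ((htr i').mp b1) b2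
  · intro h
    rw [himg] at h
    rcases h with h | h
    · rcases eq_or_eq_pt_of_pr_eq h.symm with e | e
      · subst e; exact ⟨Or.inl (Or.inl rfl), Or.inr hpi⟩
      · subst e; refine ⟨Or.inr hpi, ?_⟩; rw [pt_pt]; exact Or.inl (Or.inl rfl)
    · rcases eq_or_eq_pt_of_pr_eq h.symm with e | e
      · subst e; exact ⟨Or.inl (Or.inr rfl), Or.inr hpj⟩
      · subst e; refine ⟨Or.inr hpj, ?_⟩; rw [pt_pt]; exact Or.inl (Or.inr rfl)

omit [Field K] in
/-- the supports of the images of different pair pieces are disjoint. -/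
lemma Qpred_disjoint {s s' : Finset (Fin N)} (h : s ≠ s') (r : Finset (In N)) : Qpred N s r → ¬ Qpred N s' r := by
  intro h1 h2
  apply h
  ext c
  have e1 := h1 (xJ N c)
  have e2 := h2 (xJ N c)
  rw [pr_xJ] at e1 e2
  rw [← e1, ← e2]

/-- the diagonal products `x_c y_c` are killed by `f` (every transversal monomial meets `{x_c, y_c}`). -/
lemma gx_mul_pt_mul_f (i : In N) (q : ℕ → K) : gx K i * gx K (pt i) * w K N N q = 0 := by
  rw [gx_mul_gx, smul_mul_assoc]
  refine smul_eq_zero_of_right _ (B_mul_eq_zero_of_mem_Sp (P := Fsupp (N := N) 0) ?_ (f_mem_Sp K 0 q))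
  intro t ht hd
  by_cases h : i ∈ t
  · exact Finset.disjoint_left.mp hd (Finset.mem_insert_self i _) h
  · have h' : pt i ∈ t := by by_contra h'; exact h ((ht.1 i).mpr h')
    exact Finset.disjoint_left.mp hd (Finset.mem_insert_of_mem (Finset.mem_singleton_self _)) h'

omit [Field K] in
/-- `dup` is multiplicative. -/
lemma dup_mul (κ κ' : Equiv.Perm (Fin N)) : dup N (κ * κ') = dup N κ * dup N κ' := by
  ext i
  rcases eq_xJ_or_eq_yJ i with h | h <;> rw [h] <;> simp

omit [Field K] in
/-- `dup 1 = 1`. -/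
lemma dup_one : dup N (1 : Equiv.Perm (Fin N)) = 1 := by
  ext i
  rcases eq_xJ_or_eq_yJ i with h | h <;> rw [h] <;> simp

/-- **symmetry transport of the pieces:** `σ_κ (Pset s) = Pset (κ s)`. -/
lemma map_σκ_Pset (κ : Equiv.Perm (Fin N)) (s : Finset (Fin N)) :
    (Pset K N s).map (σκ K N κ).toLinearMap = Pset K N (s.map κ.toEmbedding) := by
  apply le_antisymm
  · rw [Submodule.map_le_iff_le_comap]
    apply Submodule.span_le.mpr
    rintro _ ⟨i, j, hi, hj, hij, rfl⟩
    rw [SetLike.mem_coe, Submodule.mem_comap, AlgEquiv.toLinearMap_apply, map_mul, σκ_gx, σκ_gx]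
    refine gx_mul_gx_mem_Pset K ?_ ?_ ?_
    · rw [pr_dup, Finset.mem_map_equiv, Equiv.symm_apply_apply]; exact hi
    · rw [pr_dup, Finset.mem_map_equiv, Equiv.symm_apply_apply]; exact hj
    · rw [pr_dup, pr_dup]; exact fun e => hij (κ.injective e)
  · apply Submodule.span_le.mpr
    rintro _ ⟨i, j, hi, hj, hij, rfl⟩
    rw [Finset.mem_map_equiv] at hi hj
    refine ⟨gx K (dup N κ⁻¹ i) * gx K (dup N κ⁻¹ j), gx_mul_gx_mem_Pset K ?_ ?_ ?_, ?_⟩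
    · rw [pr_dup]; exact hi
    · rw [pr_dup]; exact hj
    · rw [pr_dup, pr_dup]; exact fun e => hij (κ⁻¹.injective e)
    · rw [AlgEquiv.toLinearMap_apply, map_mul, σκ_gx, σκ_gx]
      congr 2 <;> rw [← Equiv.Perm.mul_apply, ← dup_mul, mul_inv_cancel, dup_one, Equiv.Perm.one_apply]

/-- transitivity of `S_N` on 2-subsets. -/
lemma exists_perm_map_eq {s s' : Finset (Fin N)} (hs : s.card = 2) (hs' : s'.card = 2) :
    ∃ κ : Equiv.Perm (Fin N), s.map κ.toEmbedding = s' := by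
  classical
  obtain ⟨c, d, hcd, rfl⟩ := Finset.card_eq_two.mp hs
  obtain ⟨c', d', hcd', rfl⟩ := Finset.card_eq_two.mp hs'
  let κ₁ : Equiv.Perm (Fin N) := Equiv.swap c c'
  have h1 : κ₁ c = c' := Equiv.swap_apply_left c c'
  have h2 : κ₁ d ≠ c' := fun e => hcd (κ₁.injective (h1.trans e.symm))
  let κ₂ : Equiv.Perm (Fin N) := Equiv.swap (κ₁ d) d'
  have h3 : κ₂ c' = c' := Equiv.swap_apply_of_ne_of_ne h2.symm hcd'
  have h4 : κ₂ (κ₁ d) = d' := Equiv.swap_apply_left _ _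
  refine ⟨κ₂ * κ₁, ?_⟩
  rw [Finset.map_insert, Finset.map_singleton]
  simp only [Equiv.toEmbedding_apply, Equiv.Perm.mul_apply, h1, h3, h4]

/-- **all pieces have the same rank** (for `|s| = |s'| = 2`). -/
lemma finrank_map_f_Pset_eq {s s' : Finset (Fin N)} (hs : s.card = 2) (hs' : s'.card = 2) (q : ℕ → K) :
    Module.finrank K ↥((Pset K N s).map (LinearMap.mulRight K (w K N N q))) =
      Module.finrank K ↥((Pset K N s').map (LinearMap.mulRight K (w K N N q))) := by
  obtain ⟨κ, hκ⟩ := exists_perm_map_eq hs hs'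
  rw [← hκ, ← map_σκ_Pset, finrank_map_f_map_σκ]

end Pieces

end Summit.Ventures.HSemireg.Wedge.Weil
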